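import Summits.NavierStokesRegularity.NavierStokesRegularity.Theses.MarginalTypeI
import Literature.Analysis.FluidPDE.ScalingUniformRecurrence
import HarnessLib.Audit

/-!
# Birth skeleton (BC3) of the crux `MarginalTypeI.NoTypeIAncient` (stmt-NavierStokesRegularity-1749)

Route `route-NavierStokesRegularity-MarginalTypeI`, crux C3 (rank 3); tree path
`Cruxes/NoTypeIAncient/Lines/birth.lean`; registrar `planner-skel-stmt-NavierStokesRegularity-1749-0`,
2026-08-17 (the route predates the Lean birth certificate; this file supplies BC3 retroactively).
`ledger crux ls stmt-NavierStokesRegularity-1749`: no workfiles at registration — no `Disproof.lean`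
(Disproof used: none available; no `_false_without_` obstruction, no landed `Negative/` lemma), no Ideas, no Lines.

THE CRUX (C3 = (L′), measurable-slice form). There is no triple `(u, p, G)` with: `u t` a.e.-strongly measurable for
every `t < 0`; `u` a mild bounded ancient solution of Navier–Stokes (`ν = 1`) on `ℝ³ × (−∞,0)`; `(u, p)` suitable weak
on the slab `(−∞,0) × ℝ³`; `G` a weak spatial gradient of `u` there; `u` not a.e. zero; and Albritton–Barker's
`𝐈(ℝ³ × ℝ₋) = typeIBound (Iio 0 ×ˢ univ) u p G < ⊤`.

THE CUT — "zoom out, pass to a minimal set of the scaling flow, kill the recurrent profile": the route's own foreseen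
layer-2 split ("C3 ⇐ {DSS case, recurrent case} shared with cards recurrent-type-i-profiles /
discrete-stabiliser-dimension-count"), typed in the RATE-FREE Albritton–Barker slab class
  𝒜 := {(w, q, H) : (w, q) suitable weak on (−∞,0) × ℝ³ (ν = 1, f = 0), H a weak spatial gradient of w there,
        𝐈(w, q, H) = typeIBound (Iio 0 ×ˢ univ) w q H < ⊤},
which is the class the crux's witnesses live in once boundedness/mildness is forgotten (the blow-down leaves the
bounded class anyway), and which is invariant under the Navier–Stokes scaling `w ↦ w_λ`.

* `stub_blowdown` [S–M; Albritton–Barker 2019 Thm 1.1, reverse direction, SLAB-WIDE form]. A member of 𝒜 that is not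
  a.e. zero has a blow-down in 𝒜 whose origin is a backward singular point. Why true: zoom out
  `w_k(t,x) = k u(t₁ + k²t, x₁ + kx)` about a point `(t₁,x₁)`, `t₁ < 0`, of essential non-vanishing
  (`exists_center_eLpNorm_top_ne_zero`); `𝐈(w_k) ≤ 𝐈(u)` (scale invariance, `abScaledSum_zoom_le_typeIBound`),
  suitability and gradients rescale (`zoom_isSuitableWeakSolutionOn`, `zoom_hasWeakSpatialGradientOn`), and
  `‖w_k‖_{L^∞(Q(0,R))} = k‖u‖_{L^∞(Q((t₁,x₁),kR))} → ∞`; the tree's ENGINE `slab_typeI_compactness` (A–B Lemma 2.2 +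
  Prop. 2.3 + l.s.c., exhausted to the slab) returns the limit in 𝒜 (`𝐈 ≤ 4𝐈(u)`) with a singular origin. The
  ball-wise version is PROVED in tree (`localTypeISingularityExists_of_suitable_nontrivial'`); the slab-wide one is
  the same proof run through the slab engine. Sources: AlbrittonBarker2019 (Thm 1.1, Lemma 2.2, Prop 2.3, §3).
* `stub_recurrentReduction` [M; Birkhoff–Furstenberg minimal set in 𝒜 — the rate-free twin of the PROVED route item
  `RecurrentProfiles.RecurrentReduction` (stmt-1590, `recurrentReduction_proof`)]. A member of 𝒜 with a singular
  origin yields a member of 𝒜 with a singular origin that is UNIFORMLY RECURRENT under scaling in `L³_loc({t ≤ 0} × ℝ³)`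
  (`Literature.Analysis.FluidPDE.IsScalingUniformlyRecurrent`). Why true: the orbit closure of `u` under
  `σ ↦ u_{e^σ}` in the `L³_loc` model space is compact (engine `slab_typeI_compactness`) and invariant; Birkhoff's
  theorem (`Literature.Dynamics.TopologicalDynamics.exists_isUniformlyRecurrentPt`, Furstenberg 1981 Thm 1.16) gives a
  uniformly recurrent point; it is identified with an engine limit (in 𝒜, `𝐈 ≤ 4𝐈(u)`, singular origin by
  persistence — every orbit point is singular at the origin). The tree proof of stmt-1590 carries the Type-I RATE along
  as a closed invariant condition and uses it nowhere else; deleting those lines proves this stub. Sources: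
  Furstenberg1981 (Ch. 1 §4, Thm 1.16), AlbrittonBarker2019 (Lemma 2.2, Prop 2.3), tree `recurrentReduction_proof`.
* `stub_recurrentLiouville` [XL; THE HEART — RECURRENT LIOUVILLE THEOREM in the rate-free class 𝒜]. A member of 𝒜 that
  is uniformly recurrent under scaling is regular at the origin (equivalently a.e. zero: tree item
  `RecurrentProfiles.RecurrentRegularIsTrivial`, PROVED, needs neither rate nor suitability). It is a STRENGTHENING of
  route RecurrentProfiles' open crux `RecurrentLiouville` (stmt-1589: same statement with the extra hypothesis
  `HasTypeITimeDecay C u`), so one proof closes both; the rate is not available here because C1 of route MarginalTypeI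
  delivers only the scaled-`L³` (cknC) Type-I bound, never a pointwise rate. Known rungs: fixed points = backward
  self-similar profiles in the local-energy class (NecasRuzickaSverak1996, Tsai1998: none); periodic orbits = λ-DSS:
  open (TypeIDSSLiouvilleConjecture) except λ ≈ 1 (ChaeWolf2017RemovingDSS Thm 1.3); axisymmetric: SereginSverak2009 /
  Seregin2020. Why it might fail: ONE Type-I λ-DSS or weakly-mixing recurrent singular profile with `𝐈 < ∞` refutes
  it (barrier `TruncatedDyadicTypeIBlowup`: the averaging-class dyadic model has exactly such DSS Type-I orbits) — the
  crux's own falsifier, now on the narrowest object (a minimal set of the scaling flow) instead of an arbitrary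
  ancient solution. Sources: AlbrittonBarker2019, KNSS2009, Tsai1998, NecasRuzickaSverak1996, ChaeWolf2017RemovingDSS,
  Furstenberg1981, PineauVicol2026.

COMPOSITION (real, this file): `NoTypeIAncient_of : <stub_blowdown sig> → <stub_recurrentReduction sig> →
<stub_recurrentLiouville sig> → Theses.MarginalTypeI.NoTypeIAncient` — pure logic: a witness `(u,p,G)` of the crux's
`∃` is a non-trivial member of 𝒜 (the measurability and mildness conjuncts are not needed); blow it down to a singular
member, pass to a uniformly recurrent singular member, and the recurrent Liouville theorem says that member is regular
at the origin — contradiction. `NoTypeIAncient_of_stubs : NoTypeIAncient` instantiates it with the three stubs BY NAME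
(kernel check that the hypothesis texts are literally the stub statements). `lean check`: rc 0; sorries = the 3 stubs,
nothing else (audit quoted in `Lines/birth.md`).
-/

noncomputable section

open Set MeasureTheory Filter Topology

namespace Summit.NavierStokesRegularity.NavierStokesRegularity.Cruxes.NoTypeIAncient.Birth

set_option linter.unusedVariables false
set_option linter.dupNamespace false

/-! ### The stubs (the ONLY sorries of this file) -/

/-- **stub 1 — `stub_blowdown` (S–M; Albritton–Barker 2019 Thm 1.1 reverse direction, slab-wide form).** A suitable
weak solution `(u,p)` of Navier–Stokes (`ν = 1`, `f = 0`) on the slab `(−∞,0) × ℝ³` with weak spatial gradient `G`,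
`𝐈 = typeIBound (Iio 0 ×ˢ univ) u p G < ⊤`, NOT a.e. zero on the slab, has a blow-down `(w,q,H)` in the same class
(suitable on the slab, weak gradient, `𝐈 < ⊤`) whose space–time origin is a backward singular point. Proof route:
zoom out about a point of essential non-vanishing and apply the tree engine `slab_typeI_compactness` (the ball-wise
statement `localTypeISingularityExists_of_suitable_nontrivial'` is proved in tree by the same steps).
Sources: AlbrittonBarker2019 Thm 1.1, Lemma 2.2, Prop 2.3, §3. -/
theorem stub_blowdown :
    ∀ (u : ℝ → EuclideanSpace ℝ (Fin 3) → EuclideanSpace ℝ (Fin 3))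
      (p : ℝ → EuclideanSpace ℝ (Fin 3) → ℝ)
      (G : ℝ → EuclideanSpace ℝ (Fin 3) → EuclideanSpace ℝ (Fin 3) →L[ℝ] EuclideanSpace ℝ (Fin 3)),
      Literature.Analysis.FluidPDE.IsSuitableWeakSolutionOn
        (Literature.Analysis.FluidPDE.slab (EuclideanSpace ℝ (Fin 3)) (Set.Iio 0) isOpen_Iio) 1 0 u p →
      Literature.Analysis.FluidPDE.HasWeakSpatialGradientOn
        (Literature.Analysis.FluidPDE.slab (EuclideanSpace ℝ (Fin 3)) (Set.Iio 0) isOpen_Iio) u G →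
      Literature.Analysis.FluidPDE.typeIBound
        (Set.Iio (0 : ℝ) ×ˢ (Set.univ : Set (EuclideanSpace ℝ (Fin 3)))) u p G < ⊤ →
      ¬ (Function.uncurry u =ᵐ[MeasureTheory.volume.restrict
          (Set.Iio (0 : ℝ) ×ˢ (Set.univ : Set (EuclideanSpace ℝ (Fin 3))))] 0) →
      ∃ (w : ℝ → EuclideanSpace ℝ (Fin 3) → EuclideanSpace ℝ (Fin 3))
        (q : ℝ → EuclideanSpace ℝ (Fin 3) → ℝ)
        (H : ℝ → EuclideanSpace ℝ (Fin 3) → EuclideanSpace ℝ (Fin 3) →L[ℝ] EuclideanSpace ℝ (Fin 3)),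
        Literature.Analysis.FluidPDE.IsSuitableWeakSolutionOn
          (Literature.Analysis.FluidPDE.slab (EuclideanSpace ℝ (Fin 3)) (Set.Iio 0) isOpen_Iio) 1 0 w q ∧
        Literature.Analysis.FluidPDE.HasWeakSpatialGradientOn
          (Literature.Analysis.FluidPDE.slab (EuclideanSpace ℝ (Fin 3)) (Set.Iio 0) isOpen_Iio) w H ∧
        Literature.Analysis.FluidPDE.typeIBound
          (Set.Iio (0 : ℝ) ×ˢ (Set.univ : Set (EuclideanSpace ℝ (Fin 3)))) w q H < ⊤ ∧
        Literature.Analysis.FluidPDE.IsBackwardSingularPoint w 0 := by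
  sorry

/-- **stub 2 — `stub_recurrentReduction` (M; Birkhoff–Furstenberg minimal set in the rate-free Albritton–Barker
slab class).** A suitable weak solution `(u,p)` on the slab with weak gradient `G`, `𝐈 < ⊤` and a backward-singular
origin yields a profile `(w,q,H)` of the same class, still singular at the origin, which is UNIFORMLY RECURRENT under
the Navier–Stokes scaling `σ ↦ w_{e^σ}` in `L³_loc({t ≤ 0} × ℝ³)` (`IsScalingUniformlyRecurrent`). Proof route: the
tree proof `recurrentReduction_proof` of `RecurrentProfiles.RecurrentReduction` (stmt-1590) with the Type-I rate lines
deleted (orbit closure compact by `slab_typeI_compactness`; `exists_isUniformlyRecurrentPt`; identification with an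
engine limit; persistence of the singular origin). Sources: Furstenberg1981 Thm 1.16, AlbrittonBarker2019 Lemma 2.2 /
Prop 2.3. -/
theorem stub_recurrentReduction :
    ∀ (u : ℝ → EuclideanSpace ℝ (Fin 3) → EuclideanSpace ℝ (Fin 3))
      (p : ℝ → EuclideanSpace ℝ (Fin 3) → ℝ)
      (G : ℝ → EuclideanSpace ℝ (Fin 3) → EuclideanSpace ℝ (Fin 3) →L[ℝ] EuclideanSpace ℝ (Fin 3)),
      Literature.Analysis.FluidPDE.IsSuitableWeakSolutionOn
        (Literature.Analysis.FluidPDE.slab (EuclideanSpace ℝ (Fin 3)) (Set.Iio 0) isOpen_Iio) 1 0 u p →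
      Literature.Analysis.FluidPDE.HasWeakSpatialGradientOn
        (Literature.Analysis.FluidPDE.slab (EuclideanSpace ℝ (Fin 3)) (Set.Iio 0) isOpen_Iio) u G →
      Literature.Analysis.FluidPDE.typeIBound
        (Set.Iio (0 : ℝ) ×ˢ (Set.univ : Set (EuclideanSpace ℝ (Fin 3)))) u p G < ⊤ →
      Literature.Analysis.FluidPDE.IsBackwardSingularPoint u 0 →
      ∃ (w : ℝ → EuclideanSpace ℝ (Fin 3) → EuclideanSpace ℝ (Fin 3))
        (q : ℝ → EuclideanSpace ℝ (Fin 3) → ℝ)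
        (H : ℝ → EuclideanSpace ℝ (Fin 3) → EuclideanSpace ℝ (Fin 3) →L[ℝ] EuclideanSpace ℝ (Fin 3)),
        Literature.Analysis.FluidPDE.IsSuitableWeakSolutionOn
          (Literature.Analysis.FluidPDE.slab (EuclideanSpace ℝ (Fin 3)) (Set.Iio 0) isOpen_Iio) 1 0 w q ∧
        Literature.Analysis.FluidPDE.HasWeakSpatialGradientOn
          (Literature.Analysis.FluidPDE.slab (EuclideanSpace ℝ (Fin 3)) (Set.Iio 0) isOpen_Iio) w H ∧
        Literature.Analysis.FluidPDE.typeIBound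
          (Set.Iio (0 : ℝ) ×ˢ (Set.univ : Set (EuclideanSpace ℝ (Fin 3)))) w q H < ⊤ ∧
        Literature.Analysis.FluidPDE.IsBackwardSingularPoint w 0 ∧
        Literature.Analysis.FluidPDE.IsScalingUniformlyRecurrent w := by
  sorry

/-- **stub 3 — `stub_recurrentLiouville` (XL; the heart: RECURRENT LIOUVILLE THEOREM in the rate-free
Albritton–Barker slab class).** A suitable weak solution `(u,p)` on the slab with weak gradient `G` and `𝐈 < ⊤` that is
uniformly recurrent under scaling in `L³_loc({t ≤ 0} × ℝ³)` is NOT backward-singular at the origin (equivalently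
a.e. zero, `RecurrentProfiles.RecurrentRegularIsTrivial`, proved in tree). A strengthening of route RecurrentProfiles'
open crux `RecurrentLiouville` (stmt-1589: the same with the extra rate hypothesis `HasTypeITimeDecay C u`). Known
rungs: self-similar (NecasRuzickaSverak1996, Tsai1998), λ-DSS with λ ≈ 1 (ChaeWolf2017RemovingDSS), axisymmetric
(SereginSverak2009, Seregin2020); open: general λ-DSS (TypeIDSSLiouvilleConjecture) and non-periodic minimal sets.
Why it might fail: one Type-I DSS / recurrent singular profile with `𝐈 < ∞` (barrier TruncatedDyadicTypeIBlowup).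
Sources: AlbrittonBarker2019, KNSS2009, Tsai1998, ChaeWolf2017RemovingDSS, Furstenberg1981, PineauVicol2026. -/
theorem stub_recurrentLiouville :
    ∀ (u : ℝ → EuclideanSpace ℝ (Fin 3) → EuclideanSpace ℝ (Fin 3))
      (p : ℝ → EuclideanSpace ℝ (Fin 3) → ℝ)
      (G : ℝ → EuclideanSpace ℝ (Fin 3) → EuclideanSpace ℝ (Fin 3) →L[ℝ] EuclideanSpace ℝ (Fin 3)),
      Literature.Analysis.FluidPDE.IsSuitableWeakSolutionOn
        (Literature.Analysis.FluidPDE.slab (EuclideanSpace ℝ (Fin 3)) (Set.Iio 0) isOpen_Iio) 1 0 u p →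
      Literature.Analysis.FluidPDE.HasWeakSpatialGradientOn
        (Literature.Analysis.FluidPDE.slab (EuclideanSpace ℝ (Fin 3)) (Set.Iio 0) isOpen_Iio) u G →
      Literature.Analysis.FluidPDE.typeIBound
        (Set.Iio (0 : ℝ) ×ˢ (Set.univ : Set (EuclideanSpace ℝ (Fin 3)))) u p G < ⊤ →
      Literature.Analysis.FluidPDE.IsScalingUniformlyRecurrent u →
      ¬ Literature.Analysis.FluidPDE.IsBackwardSingularPoint u 0 := by
  sorry

/-! ### The composition (real proof; no placeholder below this line) -/

/-- **The skeleton theorem = the composition** (concludes the crux `Theses.MarginalTypeI.NoTypeIAncient` BY NAME from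
the three stub statements, written out as hypotheses; no `sorry`). A witness `(u,p,G)` of the crux's `∃` is a
non-trivial member of the rate-free Albritton–Barker slab class; `stub_blowdown` makes it a singular member,
`stub_recurrentReduction` a uniformly recurrent singular member, and `stub_recurrentLiouville` says such a member is
regular at the origin — contradiction. (The slice-measurability and mildness conjuncts of the witness are not used:
the skeleton proves the crux through the stronger "no non-trivial slab profile with 𝐈 < ∞", equivalent to it by
Albritton–Barker's forward direction.) -/
theorem NoTypeIAncient_of :
    (∀ (u : ℝ → EuclideanSpace ℝ (Fin 3) → EuclideanSpace ℝ (Fin 3))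
      (p : ℝ → EuclideanSpace ℝ (Fin 3) → ℝ)
      (G : ℝ → EuclideanSpace ℝ (Fin 3) → EuclideanSpace ℝ (Fin 3) →L[ℝ] EuclideanSpace ℝ (Fin 3)),
      Literature.Analysis.FluidPDE.IsSuitableWeakSolutionOn
        (Literature.Analysis.FluidPDE.slab (EuclideanSpace ℝ (Fin 3)) (Set.Iio 0) isOpen_Iio) 1 0 u p →
      Literature.Analysis.FluidPDE.HasWeakSpatialGradientOn
        (Literature.Analysis.FluidPDE.slab (EuclideanSpace ℝ (Fin 3)) (Set.Iio 0) isOpen_Iio) u G →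
      Literature.Analysis.FluidPDE.typeIBound
        (Set.Iio (0 : ℝ) ×ˢ (Set.univ : Set (EuclideanSpace ℝ (Fin 3)))) u p G < ⊤ →
      ¬ (Function.uncurry u =ᵐ[MeasureTheory.volume.restrict
          (Set.Iio (0 : ℝ) ×ˢ (Set.univ : Set (EuclideanSpace ℝ (Fin 3))))] 0) →
      ∃ (w : ℝ → EuclideanSpace ℝ (Fin 3) → EuclideanSpace ℝ (Fin 3))
        (q : ℝ → EuclideanSpace ℝ (Fin 3) → ℝ)
        (H : ℝ → EuclideanSpace ℝ (Fin 3) → EuclideanSpace ℝ (Fin 3) →L[ℝ] EuclideanSpace ℝ (Fin 3)),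
        Literature.Analysis.FluidPDE.IsSuitableWeakSolutionOn
          (Literature.Analysis.FluidPDE.slab (EuclideanSpace ℝ (Fin 3)) (Set.Iio 0) isOpen_Iio) 1 0 w q ∧
        Literature.Analysis.FluidPDE.HasWeakSpatialGradientOn
          (Literature.Analysis.FluidPDE.slab (EuclideanSpace ℝ (Fin 3)) (Set.Iio 0) isOpen_Iio) w H ∧
        Literature.Analysis.FluidPDE.typeIBound
          (Set.Iio (0 : ℝ) ×ˢ (Set.univ : Set (EuclideanSpace ℝ (Fin 3)))) w q H < ⊤ ∧
        Literature.Analysis.FluidPDE.IsBackwardSingularPoint w 0) →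
    (∀ (u : ℝ → EuclideanSpace ℝ (Fin 3) → EuclideanSpace ℝ (Fin 3))
      (p : ℝ → EuclideanSpace ℝ (Fin 3) → ℝ)
      (G : ℝ → EuclideanSpace ℝ (Fin 3) → EuclideanSpace ℝ (Fin 3) →L[ℝ] EuclideanSpace ℝ (Fin 3)),
      Literature.Analysis.FluidPDE.IsSuitableWeakSolutionOn
        (Literature.Analysis.FluidPDE.slab (EuclideanSpace ℝ (Fin 3)) (Set.Iio 0) isOpen_Iio) 1 0 u p →
      Literature.Analysis.FluidPDE.HasWeakSpatialGradientOn
        (Literature.Analysis.FluidPDE.slab (EuclideanSpace ℝ (Fin 3)) (Set.Iio 0) isOpen_Iio) u G →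
      Literature.Analysis.FluidPDE.typeIBound
        (Set.Iio (0 : ℝ) ×ˢ (Set.univ : Set (EuclideanSpace ℝ (Fin 3)))) u p G < ⊤ →
      Literature.Analysis.FluidPDE.IsBackwardSingularPoint u 0 →
      ∃ (w : ℝ → EuclideanSpace ℝ (Fin 3) → EuclideanSpace ℝ (Fin 3))
        (q : ℝ → EuclideanSpace ℝ (Fin 3) → ℝ)
        (H : ℝ → EuclideanSpace ℝ (Fin 3) → EuclideanSpace ℝ (Fin 3) →L[ℝ] EuclideanSpace ℝ (Fin 3)),
        Literature.Analysis.FluidPDE.IsSuitableWeakSolutionOn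
          (Literature.Analysis.FluidPDE.slab (EuclideanSpace ℝ (Fin 3)) (Set.Iio 0) isOpen_Iio) 1 0 w q ∧
        Literature.Analysis.FluidPDE.HasWeakSpatialGradientOn
          (Literature.Analysis.FluidPDE.slab (EuclideanSpace ℝ (Fin 3)) (Set.Iio 0) isOpen_Iio) w H ∧
        Literature.Analysis.FluidPDE.typeIBound
          (Set.Iio (0 : ℝ) ×ˢ (Set.univ : Set (EuclideanSpace ℝ (Fin 3)))) w q H < ⊤ ∧
        Literature.Analysis.FluidPDE.IsBackwardSingularPoint w 0 ∧
        Literature.Analysis.FluidPDE.IsScalingUniformlyRecurrent w) →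
    (∀ (u : ℝ → EuclideanSpace ℝ (Fin 3) → EuclideanSpace ℝ (Fin 3))
      (p : ℝ → EuclideanSpace ℝ (Fin 3) → ℝ)
      (G : ℝ → EuclideanSpace ℝ (Fin 3) → EuclideanSpace ℝ (Fin 3) →L[ℝ] EuclideanSpace ℝ (Fin 3)),
      Literature.Analysis.FluidPDE.IsSuitableWeakSolutionOn
        (Literature.Analysis.FluidPDE.slab (EuclideanSpace ℝ (Fin 3)) (Set.Iio 0) isOpen_Iio) 1 0 u p →
      Literature.Analysis.FluidPDE.HasWeakSpatialGradientOn
        (Literature.Analysis.FluidPDE.slab (EuclideanSpace ℝ (Fin 3)) (Set.Iio 0) isOpen_Iio) u G →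
      Literature.Analysis.FluidPDE.typeIBound
        (Set.Iio (0 : ℝ) ×ˢ (Set.univ : Set (EuclideanSpace ℝ (Fin 3)))) u p G < ⊤ →
      Literature.Analysis.FluidPDE.IsScalingUniformlyRecurrent u →
      ¬ Literature.Analysis.FluidPDE.IsBackwardSingularPoint u 0) →
    Summit.NavierStokesRegularity.NavierStokesRegularity.Theses.MarginalTypeI.NoTypeIAncient := by
  intro hblowdown hreduction hliouville
  rintro ⟨u, p, G, -, -, hsw, hwg, hne, hI⟩
  obtain ⟨w, q, H, hsw₁, hwg₁, hI₁, hsing₁⟩ := hblowdown u p G hsw hwg hI hne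
  obtain ⟨v, π, K, hsw₂, hwg₂, hI₂, hsing₂, hrec₂⟩ := hreduction w q H hsw₁ hwg₁ hI₁ hsing₁
  exact hliouville v π K hsw₂ hwg₂ hI₂ hrec₂ hsing₂

/-- The composition instantiated with the three stubs BY NAME (kernel check that each hypothesis of
`NoTypeIAncient_of` is literally the corresponding stub statement; inherits the stubs' placeholders, adds none). -/
theorem NoTypeIAncient_of_stubs :
    Summit.NavierStokesRegularity.NavierStokesRegularity.Theses.MarginalTypeI.NoTypeIAncient :=
  NoTypeIAncient_of stub_blowdown stub_recurrentReduction stub_recurrentLiouville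

end Summit.NavierStokesRegularity.NavierStokesRegularity.Cruxes.NoTypeIAncient.Birth
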